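import Mathlib
import HarnessLib

/-!
# Stub P2 `stub_exists_goodFrame` for crux `MoebiusLimitExists` (stmt-CriticalPhenomena-1344), line `Sketch` v13
(lead prover-line-stmt-CriticalPhenomena-1344-c18-0; THEOREM-ONLY, `--supports stmt-CriticalPhenomena-1344`)

**Good frames exist.** For `n` distinct points `x₁, …, xₙ` of `ℝ³` there is an orthonormal basis `u = (u₀, u₁, u₂)`
along each vector of which the `n` projections are pairwise distinct: `⟪xᵢ − xⱼ, u_a⟫ ≠ 0` for `i ≠ j` and every `a`.

Proof (one-parameter family of reflected frames). For `t : ℝ` let `v_t := (1, t, t²)` and let `u^t` be the image of the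
standard orthonormal basis `(e₀, e₁, e₂)` under the reflection `σ_t` in the line `ℝ v_t` (`Submodule.reflection`,
`σ_t w = 2 π_{ℝ v_t} w − w`, a linear isometry, so `u^t := (EuclideanSpace.basisFun _ ℝ).map σ_t` is an orthonormal
basis).
By `Submodule.starProjection_singleton`, `π_{ℝ v} e_a = (v_a / ‖v‖²) v`, hence for `d ∈ ℝ³`
`⟪d, u^t_a⟫ = (2 tᵃ (d₀ + d₁ t + d₂ t²) − d_a (1 + t² + t⁴)) / (1 + t² + t⁴)` (`goodFrame_inner_eq`).
The numerator is a real polynomial in `t` of degree `≤ 4` which is the zero polynomial only if `d = 0` (evaluate at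
`t = 0, 1, −1, 2`), so for `d ≠ 0` the set of bad parameters `{t | ⟪d, u^t_a⟫ = 0}` is finite
(`Polynomial.finite_setOf_isRoot`; `goodFrame_bad_finite`). The finitely many nonzero differences `d = xᵢ − xⱼ` (`i ≠ j`,
`x` injective) and three indices `a` exclude a finite set of `t ∈ ℝ`; any other `t` (`Set.Finite.infinite_compl`)
gives the frame.

References: standard genericity argument (a generic orthonormal frame avoids finitely many hyperplanes). No definitions are
introduced.
-/

noncomputable section

open Set Function

namespace Summit.CriticalPhenomena.Ising3DConformalLimit.MoebiusLimitExistsSketchV13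

/-! ## The reflected frames `u^t` and their inner products -/

/-- Inner products against the reflected frame: with `v_t = (1, t, t²)` and `u^t_a = σ_{ℝ v_t} e_a` (reflection of the
standard basis vector `e_a` in the line `ℝ v_t`),
`⟪d, u^t_a⟫ = (2 tᵃ (d₀ + d₁ t + d₂ t²) − d_a (1 + t² + t⁴)) / (1 + t² + t⁴)`. [folklore] -/
theorem goodFrame_inner_eq (d : EuclideanSpace ℝ (Fin 3)) (t : ℝ) (a : Fin 3) :
    inner ℝ d (((EuclideanSpace.basisFun (Fin 3) ℝ).map
      (ℝ ∙ (!₂[1, t, t ^ 2] : EuclideanSpace ℝ (Fin 3))).reflection) a)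
      = (2 * t ^ (a : ℕ) * (d 0 + d 1 * t + d 2 * t ^ 2) - d a * (1 + t ^ 2 + t ^ 4))
          / (1 + t ^ 2 + t ^ 4) := by
  have hN : (‖(!₂[1, t, t ^ 2] : EuclideanSpace ℝ (Fin 3))‖ ^ 2 : ℝ) = 1 + t ^ 2 + t ^ 4 := by
    rw [← real_inner_self_eq_norm_sq, PiLp.inner_apply, Fin.sum_univ_three]
    simp
    ring
  have hpos : (0 : ℝ) < 1 + t ^ 2 + t ^ 4 := by positivity
  rw [OrthonormalBasis.map_apply, EuclideanSpace.basisFun_apply, Submodule.reflection_apply,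
    Submodule.starProjection_singleton ℝ, hN, two_smul, inner_sub_right, inner_add_right,
    real_inner_smul_right, EuclideanSpace.inner_single_right, EuclideanSpace.inner_single_right]
  fin_cases a <;> simp [PiLp.inner_apply, Fin.sum_univ_three] <;> field_simp <;> ring

open Polynomial in
/-- For `d ≠ 0` and each index `a`, only finitely many parameters `t` make the reflected frame vector `u^t_a` orthogonal
to `d`: the numerator of `goodFrame_inner_eq` is a nonzero real polynomial in `t` (it vanishes identically only for
`d = 0`, by evaluation at `t = 0, 1, −1, 2`), so its zero set is finite. [folklore] -/
theorem goodFrame_bad_finite (d : EuclideanSpace ℝ (Fin 3)) (hd : d ≠ 0) (a : Fin 3) :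
    Set.Finite {t : ℝ | inner ℝ d (((EuclideanSpace.basisFun (Fin 3) ℝ).map
      (ℝ ∙ (!₂[1, t, t ^ 2] : EuclideanSpace ℝ (Fin 3))).reflection) a) = 0} := by
  set P : ℝ[X] := 2 * X ^ (a : ℕ) * (C (d 0) + C (d 1) * X + C (d 2) * X ^ 2)
      - C (d a) * (1 + X ^ 2 + X ^ 4) with hP
  have hev : ∀ t : ℝ, P.eval t
      = 2 * t ^ (a : ℕ) * (d 0 + d 1 * t + d 2 * t ^ 2) - d a * (1 + t ^ 2 + t ^ 4) := by
    intro t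
    simp [hP]
  have hP0 : P ≠ 0 := by
    intro h0
    have h : ∀ t : ℝ,
        2 * t ^ (a : ℕ) * (d 0 + d 1 * t + d 2 * t ^ 2) - d a * (1 + t ^ 2 + t ^ 4) = 0 := by
      intro t
      rw [← hev t, h0, eval_zero]
    have e0 := h 0
    have e1 := h 1
    have e2 := h (-1)
    have e3 := h 2
    apply hd
    ext k
    fin_cases a <;> fin_cases k <;> simp at e0 e1 e2 e3 ⊢ <;> linarith
  refine (Polynomial.finite_setOf_isRoot hP0).subset fun t ht => ?_
  have hpos : (0 : ℝ) < 1 + t ^ 2 + t ^ 4 := by positivity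
  simp only [Set.mem_setOf_eq, goodFrame_inner_eq, div_eq_zero_iff, hpos.ne', or_false] at ht
  show P.IsRoot t
  rw [IsRoot.def, hev]
  exact ht

/-! ## The stub -/

/-- **Stub P2 — `stub_exists_goodFrame`** (registered signature). For `n` distinct points `x i` of `ℝ³` there is an
orthonormal basis `u` of `ℝ³` with `⟪x i − x j, u a⟫ ≠ 0` for all `a` and all `i ≠ j` (the projections of the points on
each basis direction are pairwise distinct). Proof: the reflected frames `u^t` (`goodFrame_inner_eq`) fail only for
`t` in a finite union of finite sets (`goodFrame_bad_finite` over the nonzero differences `x i − x j` and the three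
indices), and `ℝ` is infinite. [folklore] -/
theorem stub_exists_goodFrame : ∀ (n : ℕ) (x : Fin n → EuclideanSpace ℝ (Fin 3)), Function.Injective x →
    ∃ u : OrthonormalBasis (Fin 3) ℝ (EuclideanSpace ℝ (Fin 3)),
      ∀ (a : Fin 3) (i j : Fin n), i ≠ j → inner ℝ (x i - x j) (u a) ≠ 0 := by
  intro n x hx
  have hfin : Set.Finite (⋃ p : Fin 3 × Fin n × Fin n,
      {t : ℝ | p.2.1 ≠ p.2.2 ∧ inner ℝ (x p.2.1 - x p.2.2)
        (((EuclideanSpace.basisFun (Fin 3) ℝ).map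
          (ℝ ∙ (!₂[1, t, t ^ 2] : EuclideanSpace ℝ (Fin 3))).reflection) p.1) = 0}) := by
    refine Set.finite_iUnion fun p => ?_
    by_cases hp : p.2.1 = p.2.2
    · simp [hp]
    · exact (goodFrame_bad_finite _ (sub_ne_zero.mpr (hx.ne hp)) p.1).subset fun t ht => ht.2
  obtain ⟨t, ht⟩ := hfin.infinite_compl.nonempty
  exact ⟨(EuclideanSpace.basisFun (Fin 3) ℝ).map
      (ℝ ∙ (!₂[1, t, t ^ 2] : EuclideanSpace ℝ (Fin 3))).reflection,
    fun a i j hij h => ht (Set.mem_iUnion.mpr ⟨(a, i, j), hij, h⟩)⟩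

end Summit.CriticalPhenomena.Ising3DConformalLimit.MoebiusLimitExistsSketchV13

end
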